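import Summits.BirchSwinnertonDyer.BirchSwinnertonDyer.Theorems.ByReductionTypeAtTwoRankOneAtTwoBigImageOddLocalOneDoorSubsliceResidueShaTransport
import Summits.BirchSwinnertonDyer.BirchSwinnertonDyer.Theorems.ByReductionTypeAtTwoRankOneAtTwoBigImageOddLocalOneDoorSubsliceNegDisc
import Summits.BirchSwinnertonDyer.Rank1Residual.F1Sign2.DoorVisibilityAtTwoNegDisc
import HarnessLib

/-!
# Route ByReductionTypeAtTwo, crux `RankOneAtTwoBigImageOddLocal` (stmt-BirchSwinnertonDyer-23715), LINE v8.17 `one_door_analytic`, residue R_S at `Δ_W < 0`: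
# -desc's TRANSPORT row XT in door currency — on the `Δ_W < 0` residue {`Ш(W)[2] ≅ (ℤ/2)²`} every lawful MET transposition door datum has
# Heegner exponent `m ≥ 2 + v₂(c)`

Width prover seat `bsd-line-fkl-p2` g14 (2026-08-28), `--supports stmt-BirchSwinnertonDyer-23715` (helper).  THEOREMS ONLY; BSD is not proved by any of this.
Companion of `…OneDoorSubsliceResidueShaTransport.lean` (the `Δ_W > 0` egg residue).  The descent lens's row XT (`F1Sign2/DoorVisibilityAtTwoNegDisc.lean`,
`residueNegDoorShaTwoTransportCardAtTwo_holds`, hypothesis-free): on `OnResidueNegAtTwo W` (`Δ_W < 0`, `E(ℚ)[2] = 0`, rank `1`, `#Ш(W)[2] = 4`), at a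
transposition-admissible door `(d, q₀)` MET by `E(ℚ)` (`MeetsNonNormAt W q₀`) whose twin has rank `0`: `#Ш(W^{(d)})[2] = 4`.  In door currency: such a door is
minimal (`t = 1`, `s = 0`), `s_W ≥ 2`, `s_d ≥ 2`, so the lawful identity `2m + 1 = s_W + s_d + 1 + 2·v₂(c)` forces **`m ≥ 2 + v₂(c)`** — at every lawful
non-vanishing met transposition door datum, and under `BSDp W 2` at every non-vanishing one.

References: [Kramer1981] Prop. 3, Thm. 1; [MazurRubin2010] Prop. 3.3, Cor. 3.4 (i); [GrossLMS1991] §§2–3, §10; [SilvermanAEC2009] Thm. X.4.2.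
-/

set_option autoImplicit false
-- the Theorems namespace of this sub repeats the summit name by design (D-0017 nested layout)
set_option linter.dupNamespace false

noncomputable section

open scoped Classical

namespace Summit.BirchSwinnertonDyer.BirchSwinnertonDyer.Theorems.RankOneAtTwoOneDoor

open WeierstrassCurve NumberField Literature.NumberTheory.EllipticCurves Literature.NumberTheory.EllipticCurves.ModularForms
  Summit.BirchSwinnertonDyer.Rank1Residual.F1Sign2
  Summit.BirchSwinnertonDyer.Rank1Residual.F1Sign2.TranspositionDoor
  Summit.BirchSwinnertonDyer.BirchSwinnertonDyer.Theses.ByReductionTypeAtTwo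
open Summit.BirchSwinnertonDyer.Rank1Residual.F1Sign2.TranspDoorVisibility (OnResidueNegAtTwo residueNegDoorShaTwoTransportCardAtTwo_holds)

/-- **`s_d ≥ 2` on the `Δ_W < 0` residue at a rank-`0` MET transposition door, on ANY model of the twin** (row XT + `card_primaryComponent_sha_variableChange`).
[cite: Kramer1981, Prop. 3] [cite: MazurRubin2010, Cor. 3.4 (i)] [cite: SilvermanAEC2009, X.§4] -/
theorem two_le_sd_of_residueNeg (W : WeierstrassCurve ℚ) [W.IsElliptic] [W.IsGloballyMinimal] [W.IsIntegral ℤ] (hres : OnResidueNegAtTwo W) {d : ℤ}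
    {q₀ : ℕ} [Fact q₀.Prime] (htr : TranspAdmissible W d q₀) (hmeets : MeetsNonNormAt W q₀) (hr0 : (W.quadraticTwist (d : ℚ)).mordellWeilRank = 0)
    (Wd : WeierstrassCurve ℚ) (Cd : VariableChange ℚ) (hWd : Cd • W.quadraticTwist (d : ℚ) = Wd)
    [Finite (AddCommGroup.primaryComponent Wd.sha 2)] :
    2 ≤ padicValNat 2 (Nat.card (AddCommGroup.primaryComponent Wd.sha 2)) := by
  have h4 : shaTwoCard (W.quadraticTwist (d : ℚ)) = 4 := residueNegDoorShaTwoTransportCardAtTwo_holds W hres d q₀ htr hmeets hr0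
  have hcard : Nat.card (AddCommGroup.primaryComponent Wd.sha 2) = Nat.card (AddCommGroup.primaryComponent (W.quadraticTwist (d : ℚ)).sha 2) := by
    rw [← hWd]; exact WeierstrassCurve.card_primaryComponent_sha_variableChange _ _ 2
  haveI : Finite (AddCommGroup.primaryComponent (W.quadraticTwist (d : ℚ)).sha 2) := by
    have e : Cd⁻¹ • Wd = W.quadraticTwist (d : ℚ) := by rw [← hWd, inv_smul_smul]
    rw [← e]
    exact WeierstrassCurve.finite_primaryComponent_sha_variableChange Wd Cd⁻¹ 2
  rw [hcard]
  exact two_le_padicValNat_of_four_dvd (Nat.card_pos.ne') (four_dvd_natCard_primaryComponent_of_shaTwoCard_eq_four _ h4)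

/-- **ON THE `Δ_W < 0` RESIDUE, A LAWFUL MET TRANSPOSITION DOOR DATUM HAS HEEGNER EXPONENT `m ≥ 2 + v₂(c)`.**  `W/ℚ` globally minimal, analytic rank `1`,
`rank E(ℚ) = 1`, on -desc's `Δ_W < 0` residue (`E(ℚ)[2] = 0`, `#Ш(W)[2] = 4`); `K` imaginary quadratic with `(d_K, q₀)` transposition-admissible, the door MET
(`MeetsNonNormAt W q₀`) and NON-VANISHING; Gross–Zagier and Kolyvagin at `K`, modularity (for `rank W^{(d_K)}(ℚ) = 0`); any datum, `Wd` a model of the twist,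
both `Ш[2^∞]` finite; an exponent `m` with the lawful identity.  THEN `2 + v₂(c) ≤ m` (`t = 1`, `s = 0`, `s_W ≥ 2`, `s_d ≥ 2`).  CONDITIONAL by design.
[cite: Kramer1981, Prop. 3 and Thm. 1] [cite: MazurRubin2010, Prop. 3.3 and Cor. 3.4 (i)] [cite: GrossLMS1991, §§2–3 and §10] -/
theorem exponent_ge_two_add_padicVal_of_lawful_at_residueNeg (hnf : exists_isNewformOf)
    (W : WeierstrassCurve ℚ) [W.IsElliptic] [W.IsGloballyMinimal] [W.IsIntegral ℤ] [NeZero (W.conductorNorm ℤ)]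
    (hr : W.analyticRank = 1) (hrQ : W.mordellWeilRank = 1) (hres : OnResidueNegAtTwo W)
    (K : Type) [Field K] [NumberField K] (hK : IsImaginaryQuadratic K)
    (hGZ : gross_zagier (W.conductorNorm ℤ) W K) (hKo : kolyvagin (W.conductorNorm ℤ) W K)
    {q₀ : ℕ} [Fact q₀.Prime] (htr : TranspAdmissible W (NumberField.discr K) q₀) (hmeets : MeetsNonNormAt W q₀)
    (hLt : (W.quadraticTwist (NumberField.discr K : ℚ)).entireLFunction 1 ≠ 0)
    (Dt : ModularParametrizationData W (W.conductorNorm ℤ)) (H : HeegnerDatum (W.conductorNorm ℤ) (NumberField.discr K)) (ι : K →+* ℂ)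
    (P : (W.baseChange K).toAffine.Point) (hP : WeierstrassCurve.Affine.Point.map ι.toRatAlgHom P = heegnerPointComplex Dt H)
    (Wd : WeierstrassCurve ℚ) [Wd.IsElliptic] (Cd : VariableChange ℚ) (hWd : Cd • W.quadraticTwist (NumberField.discr K : ℚ) = Wd)
    [Finite (AddCommGroup.primaryComponent W.sha 2)] [Finite (AddCommGroup.primaryComponent Wd.sha 2)]
    (m : ℕ)
    (hlaw : 2 * m + (if W.Δ < 0 then 1 else 0) =
      padicValNat 2 (Nat.card (AddCommGroup.primaryComponent W.sha 2)) +
        padicValNat 2 (Nat.card (AddCommGroup.primaryComponent Wd.sha 2)) +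
        transpCount W (NumberField.discr K) + 2 * identCount W (NumberField.discr K) + 2 * padicValInt 2 Dt.c) :
    2 + padicValInt 2 Dt.c ≤ m := by
  have hmod : hasEntireLFunction_rat := hasEntireLFunction_rat_of_exists_isNewformOf hnf
  have hres' := hres
  obtain ⟨hΔ, -, -, hsha4⟩ := hres'
  have hadm : DoorAdmissible W (NumberField.discr K) := ANg16.doorAdmissible_of_transpAdmissible W htr
  obtain ⟨hrkK, -, -, -⟩ := exists_unique_exponent_at_door hmod W hr K hK hGZ hKo hadm hLt Dt H ι P hP
  have hr0 : (W.quadraticTwist (NumberField.discr K : ℚ)).mordellWeilRank = 0 :=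
    mordellWeilRank_twin_eq_zero W K hK.1 hrkK hrQ (W.quadraticTwist (NumberField.discr K : ℚ)) 1 (one_smul _ _)
  have hsW := two_le_sW_of_shaTwoCard_eq_four W hsha4
  have hsd := two_le_sd_of_residueNeg W hres htr hmeets hr0 Wd Cd hWd
  rw [transpCount_eq_one_of_transpAdmissible W htr, identCount_eq_zero_of_transpAdmissible W htr, if_pos hΔ] at hlaw
  omega

/-- **UNDER `BSDp W 2`, EVERY NON-VANISHING MET TRANSPOSITION DOOR DATUM OF A `Δ_W < 0` RESIDUE CURVE HAS HEEGNER EXPONENT `m ≥ 2 + v₂(c)`** (BSD-predicted,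
falsifiable; -desc's PT censuses).  Per-datum kernel iff + uniqueness of the exponent + the previous theorem.  CONDITIONAL by design; BSD is not proved by this.
[cite: GrossZagier1986, Thm. I.6.3 and V.§2] [cite: Kramer1981, Prop. 3] [cite: MazurRubin2010, Cor. 3.4 (i)] -/
theorem exponent_ge_two_add_padicVal_of_bsdp_two_at_residueNeg
    (hGZ : ∀ (N : ℕ) [NeZero N] (W : WeierstrassCurve ℚ) (K : Type) [Field K] [NumberField K], gross_zagier N W K)
    (hKo : ∀ (N : ℕ) [NeZero N] (W : WeierstrassCurve ℚ) (K : Type) [Field K] [NumberField K], kolyvagin N W K)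
    (hnf : exists_isNewformOf) (hHL : HoffsteinLuo1997_exists_twist_L_one_ne_zero)
    (W : WeierstrassCurve ℚ) [W.IsElliptic] [W.IsGloballyMinimal] [W.IsIntegral ℤ] [NeZero (W.conductorNorm ℤ)]
    (hT : Odd W.torsionOrder) (hc : Odd W.tamagawaProduct) (hr : W.analyticRank = 1) (hres : OnResidueNegAtTwo W) (hB : BSDp W 2)
    (K : Type) [Field K] [NumberField K] (hK : IsImaginaryQuadratic K)
    {q₀ : ℕ} [Fact q₀.Prime] (htr : TranspAdmissible W (NumberField.discr K) q₀) (hmeets : MeetsNonNormAt W q₀)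
    (hLt : (W.quadraticTwist (NumberField.discr K : ℚ)).entireLFunction 1 ≠ 0)
    (Dt : ModularParametrizationData W (W.conductorNorm ℤ)) (H : HeegnerDatum (W.conductorNorm ℤ) (NumberField.discr K)) (ι : K →+* ℂ)
    (P : (W.baseChange K).toAffine.Point) (hP : WeierstrassCurve.Affine.Point.map ι.toRatAlgHom P = heegnerPointComplex Dt H)
    (Wd : WeierstrassCurve ℚ) [Wd.IsElliptic] [Wd.IsGloballyMinimal] (Cd : VariableChange ℚ)
    (hWd : Cd • W.quadraticTwist (NumberField.discr K : ℚ) = Wd) (hBd : BSDp Wd 2)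
    (m : ℕ) (hm : HasTwoDivisibilityUpToTorsion W K P m) : 2 + padicValInt 2 Dt.c ≤ m := by
  have hmod : hasEntireLFunction_rat := hasEntireLFunction_rat_of_exists_isNewformOf hnf
  have hrQ : W.mordellWeilRank = 1 := (mordellWeilRank_eq_one_of_analyticRank_eq_one_of_isGloballyMinimal hGZ hKo hnf hHL W hr).1
  have hadm : DoorAdmissible W (NumberField.discr K) := ANg16.doorAdmissible_of_transpAdmissible W htr
  have hHN : SatisfiesHeegnerHypothesis (W.conductorNorm ℤ) K := satisfiesHeegnerHypothesis_of_doorAdmissible W K hK hadm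
  obtain ⟨hfinW, hfinD, hiff⟩ :=
    bsdp_two_iff_doorLawFullC_at_of_rank hmod doorTwistTamagawaAtTwo W hT hc hr hrQ K hK (hGZ _ W K) (hKo _ W K) hadm hHN hLt Dt H ι P hP Wd Cd hWd hBd
  haveI := hfinW
  haveI := hfinD
  obtain ⟨m', hm', hlaw⟩ := hiff.mp hB
  obtain ⟨-, -, -, huniq⟩ := exists_unique_exponent_at_door hmod W hr K hK (hGZ _ W K) (hKo _ W K) hadm hLt Dt H ι P hP
  have hmm : m = m' := huniq m m' hm hm'
  subst hmm
  exact exponent_ge_two_add_padicVal_of_lawful_at_residueNeg hnf W hr hrQ hres K hK (hGZ _ W K) (hKo _ W K) htr hmeets hLt Dt H ι P hP Wd Cd hWd m hlaw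

end Summit.BirchSwinnertonDyer.BirchSwinnertonDyer.Theorems.RankOneAtTwoOneDoor

end
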